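import Summits.BirchSwinnertonDyer.BirchSwinnertonDyer.Theses.SemiOrdinaryEisensteinDescent
import Literature.NumberTheory.EllipticCurves.HeegnerPointsIdentityComponentProofs
import HarnessLib

/-!
# Route `SemiOrdinaryEisensteinDescent`: the print support `KolyvaginPrimitivesAtThree`
# (stmt-BirchSwinnertonDyer-25896) from its three Literature names, with the Gross 1991 `E⁰`
# conjunct (`GrossHeegnerPointE0Input`, stmt-BirchSwinnertonDyer-24701) read through the image-free
# Gross–Zagier III (3.1) fact

`KolyvaginPrimitivesAtThree := CasselsTateLevelInputsFact ∧ GrossProp372FrobeniusCongruenceInput ∧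
GrossHeegnerPointE0Input` is the bundle of the three McCallum-road primitives BY NAME that the route's
`closes` consumes (binder `hPr`): the levelwise Cassels–Tate inputs
(`Literature.NumberTheory.EllipticCurves.casselsTate_levelInputs K` for every number field `K`), Gross 1991
Prop. 3.7 (2) (`GrossLMS1991.prop37_2_frobeniusCongruence`) and Gross 1991 §6 ∕ GZ86 III (3.1) «the Heegner
point minus a rational torsion point lies in `E⁰`» (`Gross1991_heegnerPoint_sub_ratTorsion_mem_E0`).

This file is pure by-name bookkeeping for the pen (cell `bsd-wall`, D-0154 (2) INPUTS seat
`bsd-inputs-r2-p3`, row 2 p3): it records (i) the unfoldings of the two item declarations to their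
Literature names (`Iff.rfl`), (ii) the projections and the constructor of the bundle, and (iii) the ONE
substantive rewiring available in the tree — conjunct 3 follows from the IMAGE-FREE reading
`Gross1991_heegnerPoint_sub_ratTorsion_mem_E0_imageFree` of the same printed sentence (no `¬ HasCM`, no
surjectivity of `ρ̄_{E,p}`, W. Zhang's Kolyvagin primes ⊇ Gross's (3.1)–(3.2)) by
`Gross1991_heegnerPoint_sub_ratTorsion_mem_E0_of_imageFree` (proof file
`HeegnerPointsIdentityComponentProofs`, p608907) — so that `KolyvaginPrimitivesAtThree` is supplied from
`{casselsTate_levelInputs ∀ K, prop37_2_frobeniusCongruence, …_mem_E0_imageFree}`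
(`kolyvaginPrimitivesAtThree_of_literature_imageFree`): the published input [GZ86 III (3.1)] is then ONE
displayed Literature name across this route and the image-free consumers (cells `bsd-potss`, `PrintX10b`).

HONEST FRAMING: nothing here discharges any of the three primitives — each stays a cited, unproved
Literature input (sizes XL ∕ L ∕ XL as typed; for conjunct 3 see the size verdict in the module docstring
of `HeegnerPointsIdentityComponentProofs`: the printed proof needs integral models of `X₀(N)`, Néron
models of `J₀(N)` and Manin–Drinfeld, none in the tree); items 25896 and 24701 stay OPEN; every theorem
below is conditional on the hypotheses it displays; no summit statement is proved; BSD is not proved by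
any of this.

References: [GrossLMS1991] §6 proof of Prop. 6.2 (1) (p. 245), Prop. 3.7 (2) (p. 240), §5 (5.1);
[GrossZagier1986Heegner] III (3.1) (p. 256); [WZhang2014] Notations (xii); [McCallumLMS1991] §5
Thm. 5.4 ∕ 5.8; [MilneADT2006] I §6.
-/

set_option autoImplicit false
set_option linter.dupNamespace false

namespace Summit.BirchSwinnertonDyer.BirchSwinnertonDyer.Theorems.SemiOrdinaryEisensteinDescentKolyvaginPrimitivesAtThreeOfImageFree

open Summit.BirchSwinnertonDyer.BirchSwinnertonDyer.Theses.SemiOrdinaryEisensteinDescent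
open Literature.NumberTheory.EllipticCurves

/-! ## §1 The two item declarations, unfolded to their Literature names -/

/-- **Item 24701 IS the Gross-scoped named fact** `Gross1991_heegnerPoint_sub_ratTorsion_mem_E0`
(by `Iff.rfl`: the route declaration `GrossHeegnerPointE0Input` has that constant as its body).
[cite: GrossLMS1991, §6, proof of Prop. 6.2 (1), p. 245] -/
theorem grossHeegnerPointE0Input_iff :
    GrossHeegnerPointE0Input ↔ Gross1991_heegnerPoint_sub_ratTorsion_mem_E0 :=
  Iff.rfl

/-- **Item 25896 IS the conjunction of its three Literature names** (by `Iff.rfl`).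
[cite: GrossLMS1991, Prop. 3.7 (2) (p. 240) and §6 (p. 245)] [cite: MilneADT2006, I §6] -/
theorem kolyvaginPrimitivesAtThree_iff :
    KolyvaginPrimitivesAtThree ↔
      (∀ (K : Type) [Field K] [NumberField K], casselsTate_levelInputs K) ∧
        GrossLMS1991.prop37_2_frobeniusCongruence ∧
          Gross1991_heegnerPoint_sub_ratTorsion_mem_E0 :=
  Iff.rfl

/-! ## §2 Conjunct 3 through the image-free Gross–Zagier III (3.1) fact -/

/-- **Item 24701 ⟸ the image-free reading of the same printed sentence**: the Gross-scoped `E⁰` fact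
is the special case (`¬ HasCM`, `ρ̄_{E,p}` onto, Gross's Kolyvagin primes) of
`Gross1991_heegnerPoint_sub_ratTorsion_mem_E0_imageFree`, by
`Gross1991_heegnerPoint_sub_ratTorsion_mem_E0_of_imageFree` (p608907). Turnkey for a pen re-glue of
conjunct 3. [cite: GrossLMS1991, §6, proof of Prop. 6.2 (1), p. 245]
[cite: GrossZagier1986Heegner, III (3.1) Proposition, p. 256] -/
theorem grossHeegnerPointE0Input_of_imageFree
    (hIF : Gross1991_heegnerPoint_sub_ratTorsion_mem_E0_imageFree) : GrossHeegnerPointE0Input :=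
  Gross1991_heegnerPoint_sub_ratTorsion_mem_E0_of_imageFree hIF

/-! ## §3 The bundle: projections, constructor, and the image-free supply -/

/-- Projection 1: the levelwise Cassels–Tate inputs (item 20191) from the bundle.
[cite: MilneADT2006, I §6] -/
theorem casselsTateLevelInputsFact_of_kolyvaginPrimitivesAtThree (h : KolyvaginPrimitivesAtThree) :
    CasselsTateLevelInputsFact :=
  h.1

/-- Projection 2: Gross 1991 Prop. 3.7 (2) (item 23091) from the bundle.
[cite: GrossLMS1991, Prop. 3.7 (2) (p. 240)] -/
theorem grossProp372FrobeniusCongruenceInput_of_kolyvaginPrimitivesAtThree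
    (h : KolyvaginPrimitivesAtThree) : GrossProp372FrobeniusCongruenceInput :=
  h.2.1

/-- Projection 3: the Gross 1991 `E⁰` fact (item 24701) from the bundle.
[cite: GrossLMS1991, §6, proof of Prop. 6.2 (1), p. 245] -/
theorem grossHeegnerPointE0Input_of_kolyvaginPrimitivesAtThree (h : KolyvaginPrimitivesAtThree) :
    GrossHeegnerPointE0Input :=
  h.2.2

/-- Constructor: the three item declarations give the bundle (item 25896 ⟸ 20191 ∧ 23091 ∧ 24701,
verbatim its body). [cite: GrossLMS1991, Prop. 3.7 (2) (p. 240) and §6 (p. 245)] -/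
theorem kolyvaginPrimitivesAtThree_of_parts (hCT : CasselsTateLevelInputsFact)
    (h372 : GrossProp372FrobeniusCongruenceInput) (hE0 : GrossHeegnerPointE0Input) :
    KolyvaginPrimitivesAtThree :=
  ⟨hCT, h372, hE0⟩

/-- **The bundle with conjunct 3 read image-free**: items 20191 and 23091 together with the image-free
GZ86 III (3.1) fact give `KolyvaginPrimitivesAtThree` (conjunct 3 by
`grossHeegnerPointE0Input_of_imageFree`). [cite: GrossLMS1991, §6, proof of Prop. 6.2 (1), p. 245]
[cite: GrossZagier1986Heegner, III (3.1) Proposition, p. 256] -/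
theorem kolyvaginPrimitivesAtThree_of_imageFree (hCT : CasselsTateLevelInputsFact)
    (h372 : GrossProp372FrobeniusCongruenceInput)
    (hIF : Gross1991_heegnerPoint_sub_ratTorsion_mem_E0_imageFree) : KolyvaginPrimitivesAtThree :=
  ⟨hCT, h372, grossHeegnerPointE0Input_of_imageFree hIF⟩

/-- **Item 25896 from three Literature names, the `E⁰` one image-free** — the shape a pen re-split of
25896 would display: `casselsTate_levelInputs` for every number field, Gross 1991 Prop. 3.7 (2), and
`Gross1991_heegnerPoint_sub_ratTorsion_mem_E0_imageFree`. CONDITIONAL on all three (each an unproved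
cited input). [cite: GrossLMS1991, Prop. 3.7 (2) (p. 240); §6, proof of Prop. 6.2 (1) (p. 245)]
[cite: GrossZagier1986Heegner, III (3.1) Proposition, p. 256] [cite: MilneADT2006, I §6] -/
theorem kolyvaginPrimitivesAtThree_of_literature_imageFree
    (hCT : ∀ (K : Type) [Field K] [NumberField K], casselsTate_levelInputs K)
    (h372 : GrossLMS1991.prop37_2_frobeniusCongruence)
    (hIF : Gross1991_heegnerPoint_sub_ratTorsion_mem_E0_imageFree) : KolyvaginPrimitivesAtThree :=
  ⟨hCT, h372, Gross1991_heegnerPoint_sub_ratTorsion_mem_E0_of_imageFree hIF⟩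

end Summit.BirchSwinnertonDyer.BirchSwinnertonDyer.Theorems.SemiOrdinaryEisensteinDescentKolyvaginPrimitivesAtThreeOfImageFree
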